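import Mathlib
import Summits.Ventures.PercRepro2.LocRows
import Summits.Ventures.PercRepro2.SwRow
import Summits.Ventures.PercRepro2.SwOut
import Summits.Ventures.PercRepro2.SwAllRow
import Summits.Ventures.PercRepro2.SwOutAll
import Summits.Ventures.PercRepro2.BasePrime
import Summits.Ventures.PercRepro2.SwOutArmFlip
import Summits.Ventures.PercRepro2.SwOutArms

/-!
# The orbit of a core-free configuration under arm flips (blind cell PercRepro2, night-4 g10,
2026-08-25; proofs/NIGHT4-G10.md §7, the ARM PRINCIPLE, part 3)

`allRed ζ h` is the all-red orientation of a core-free `ζ` (its blue arms flipped); for a cube point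
`ω : Config (arms ζ h)` the realisation `orbitReal ζ h ω` flips the arms assigned `false` of the
all-red orientation.  This file: the all-red orientation (`cluster_allRed`, `cluster_blue_allRed`,
`hull_allRed`, `coreFree_allRed`, `allRed_mem_outClass`), the transfer of arm-closedness along equal
hulls, the partition of `hull ∖ {h}` by an `ω` (`armsFalse_union_armsTrue`), the composition of
arm flips (`flip_armsFalse_eq`) and the clusters of the realisation (`cluster_orbitReal`,
`cluster_blue_orbitReal`).
-/

namespace Summit.Ventures.PercRepro2

namespace LocRows

open Hull

variable {V : Type*} {E : Type*} [Fintype E] [DecidableEq E]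

open scoped Classical

variable (ends : E → Sym2 V)

/-- The all-red orientation: the blue arms flipped. -/
noncomputable def allRed (ζ : Config E) (h : V) : Config E :=
  flip ends (cluster ends (blue ζ) h \ {h}) ζ

/-- The realisation of a cube point: the arms assigned `false` are flipped in the all-red
orientation. -/
noncomputable def orbitReal (ζ : Config E) (h : V) (ω : Config (arms ends ζ h)) : Config E :=
  flip ends (armsFalse ends ζ h ω) (allRed ends ζ h)

/-- The union of the arms assigned `true`. -/
def armsTrue (ζ : Config E) (h : V) (ω : Config (arms ends ζ h)) : Set V :=
  {x | ∃ P : arms ends ζ h, ω P = true ∧ x ∈ P.1}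

variable {ends}

section AllRed

variable {ζ : Config E} {h : V}

omit [Fintype E] [DecidableEq E] in
/-- The blue side minus `h` is arm-closed. -/
lemma armClosed_blueSide (hc : CoreFree ends ζ h) :
    ArmClosed ends ζ h (cluster ends (blue ζ) h \ {h}) := by
  refine ⟨fun x hx => ⟨Or.inr hx.1, hx.2⟩, fun e x y hxy hx hyH hyh => ?_⟩
  refine ⟨?_, hyh⟩
  rcases hyH with hyT | hyTp
  · exact absurd (no_edge_sides_of_coreFree hc (ends_swap hxy) hyT hyh hx.1 hx.2) id
  · exact hyTp

omit [Fintype E] [DecidableEq E] in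
/-- The red cluster of the all-red orientation is the hull. -/
theorem cluster_allRed (hc : CoreFree ends ζ h) : cluster ends (allRed ends ζ h) h = hull ends ζ h := by
  unfold allRed
  rw [cluster_flip_of_armClosed hc (armClosed_blueSide hc)]
  ext x
  simp only [Set.mem_union, Set.mem_sdiff, Set.mem_inter_iff, Set.mem_singleton_iff, hull]
  constructor
  · rintro (⟨h1, _⟩ | ⟨⟨h2, _⟩, _⟩)
    · exact Or.inl h1
    · exact Or.inr h2
  · rintro (h1 | h2)
    · by_cases hx : x ∈ cluster ends (blue ζ) h ∧ x ≠ h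
      · exact Or.inr ⟨hx, hx.1⟩
      · exact Or.inl ⟨h1, hx⟩
    · by_cases hxh : x = h
      · subst hxh; exact Or.inl ⟨mem_cluster_self _ _ _, fun h' => h'.2 rfl⟩
      · exact Or.inr ⟨⟨h2, hxh⟩, h2⟩

omit [Fintype E] [DecidableEq E] in
/-- The blue cluster of the all-red orientation is `{h}`. -/
theorem cluster_blue_allRed (hc : CoreFree ends ζ h) :
    cluster ends (blue (allRed ends ζ h)) h = {h} := by
  unfold allRed
  rw [cluster_blue_flip_of_armClosed hc (armClosed_blueSide hc)]
  ext x
  simp only [Set.mem_union, Set.mem_sdiff, Set.mem_inter_iff, Set.mem_singleton_iff]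
  constructor
  · rintro (⟨h1, h2⟩ | ⟨⟨h1, h2⟩, h3⟩)
    · by_contra hxh; exact h2 ⟨h1, hxh⟩
    · exact hc x h3 h1
  · rintro rfl
    exact Or.inl ⟨mem_cluster_self _ _ _, fun h' => h'.2 rfl⟩

omit [Fintype E] [DecidableEq E] in
/-- The hull of the all-red orientation. -/
theorem hull_allRed (hc : CoreFree ends ζ h) : hull ends (allRed ends ζ h) h = hull ends ζ h :=
  hull_flip_of_armClosed hc (armClosed_blueSide hc)

omit [Fintype E] [DecidableEq E] in
/-- The all-red orientation is core-free. -/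
theorem coreFree_allRed (hc : CoreFree ends ζ h) : CoreFree ends (allRed ends ζ h) h :=
  coreFree_flip_of_armClosed hc (armClosed_blueSide hc)

/-- The all-red orientation lies in the class. -/
theorem allRed_mem_outClass {U : Set V} {ξ : Config E} (hζ : ζ ∈ outClass ends U h ξ)
    (hc : CoreFree ends ζ h) : allRed ends ζ h ∈ outClass ends U h ξ :=
  flip_mem_outClass_of_armClosed hζ hc (armClosed_blueSide hc)

omit [Fintype E] [DecidableEq E] in
/-- Arm-closedness only depends on the hull. -/
lemma armClosed_of_hull_eq {ζ' : Config E} (hh : hull ends ζ' h = hull ends ζ h) {P : Set V}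
    (hP : ArmClosed ends ζ h P) : ArmClosed ends ζ' h P := by
  refine ⟨fun x hx => ?_, fun e x y hxy hx hyH hyh => ?_⟩
  · rw [hh]; exact hP.subset x hx
  · rw [hh] at hyH; exact hP.closed e x y hxy hx hyH hyh

end AllRed

section Orbit

variable {ζ : Config E} {h : V}

omit [DecidableEq E] in
/-- A vertex of `armsFalse ω` lies in `hull ∖ {h}`. -/
lemma mem_hull_sdiff_of_mem_armsFalse {ω : Config (arms ends ζ h)} {x : V}
    (hx : x ∈ armsFalse ends ζ h ω) : x ∈ hull ends ζ h ∧ x ≠ h := by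
  obtain ⟨P, _, hxP⟩ := hx
  exact mem_hull_sdiff_of_mem_arms P.2 hxP

omit [DecidableEq E] in
/-- A vertex of `armsTrue ω` lies in `hull ∖ {h}`. -/
lemma mem_hull_sdiff_of_mem_armsTrue {ω : Config (arms ends ζ h)} {x : V}
    (hx : x ∈ armsTrue ends ζ h ω) : x ∈ hull ends ζ h ∧ x ≠ h := by
  obtain ⟨P, _, hxP⟩ := hx
  exact mem_hull_sdiff_of_mem_arms P.2 hxP

omit [DecidableEq E] in
/-- `armsFalse` and `armsTrue` are disjoint. -/
lemma armsFalse_disjoint_armsTrue {ω : Config (arms ends ζ h)} {x : V}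
    (hF : x ∈ armsFalse ends ζ h ω) (hT : x ∈ armsTrue ends ζ h ω) : False := by
  obtain ⟨P, hP, hxP⟩ := hF
  obtain ⟨Q, hQ, hxQ⟩ := hT
  have : P = Q := Subtype.ext (arms_eq_of_mem P.2 Q.2 hxP hxQ)
  subst this
  rw [hP] at hQ; exact absurd hQ (by decide)

omit [DecidableEq E] in
/-- `armsFalse ω ∪ armsTrue ω = hull ∖ {h}`. -/
lemma mem_armsFalse_or_armsTrue {ω : Config (arms ends ζ h)} {x : V} (hx : x ∈ hull ends ζ h)
    (hxh : x ≠ h) : x ∈ armsFalse ends ζ h ω ∨ x ∈ armsTrue ends ζ h ω := by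
  obtain ⟨P, hP, hxP⟩ := exists_mem_arms hx hxh
  cases hω : ω ⟨P, hP⟩ with
  | false => exact Or.inl ⟨⟨P, hP⟩, hω, hxP⟩
  | true => exact Or.inr ⟨⟨P, hP⟩, hω, hxP⟩

omit [DecidableEq E] in
/-- The arms assigned `false` by the flip of `ω` are the arms assigned `true` by `ω`. -/
lemma armsFalse_flipAll (ω : Config (arms ends ζ h)) :
    armsFalse ends ζ h (flipAll ω) = armsTrue ends ζ h ω := by
  ext x
  simp only [armsFalse, armsTrue, Set.mem_setOf_eq, flipAll, Bool.not_eq_false']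

omit [DecidableEq E] in
/-- The arms assigned `false` shrink as `ω` grows. -/
lemma armsFalse_anti {ω ω' : Config (arms ends ζ h)} (hω : ω ≤ ω') :
    armsFalse ends ζ h ω' ⊆ armsFalse ends ζ h ω := by
  rintro x ⟨P, hP, hxP⟩
  refine ⟨P, ?_, hxP⟩
  have := hω P
  rw [hP] at this
  cases h' : ω P
  · rfl
  · rw [h'] at this
    exact absurd this (by simp)

omit [DecidableEq E] in
/-- No edge joins `armsFalse ω` to `armsTrue ω`. -/
lemma no_edge_armsFalse_armsTrue {ω : Config (arms ends ζ h)} {e : E} {x y : V}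
    (hxy : ends e = s(x, y)) (hx : x ∈ armsFalse ends ζ h ω) (hy : y ∈ armsTrue ends ζ h ω) :
    False := by
  obtain ⟨P, hP, hxP⟩ := hx
  have hyH := mem_hull_sdiff_of_mem_armsTrue hy
  have hyP : y ∈ P.1 := (armClosed_of_mem_arms P.2).closed e x y hxy hxP hyH.1 hyH.2
  exact armsFalse_disjoint_armsTrue ⟨P, hP, hyP⟩ hy

omit [DecidableEq E] in
/-- A union of arms selected by any predicate is arm-closed. -/
lemma armClosed_armsSel (p : arms ends ζ h → Prop) :
    ArmClosed ends ζ h {x | ∃ P : arms ends ζ h, p P ∧ x ∈ P.1} := by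
  have : {x | ∃ P : arms ends ζ h, p P ∧ x ∈ P.1} = ⋃ P : {P : arms ends ζ h // p P}, P.1.1 := by
    ext x
    simp only [Set.mem_setOf_eq, Set.mem_iUnion]
    constructor
    · rintro ⟨P, hP, hx⟩; exact ⟨⟨P, hP⟩, hx⟩
    · rintro ⟨⟨P, hP⟩, hx⟩; exact ⟨P, hP, hx⟩
  rw [this]
  exact armClosed_iUnion _ fun P => armClosed_of_mem_arms P.1.2

omit [DecidableEq E] in
/-- No edge joins two different arms (selected by two disjoint predicates). -/
lemma not_touches_both_of_disjoint_sel {p q : arms ends ζ h → Prop} (hpq : ∀ P, p P → q P → False)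
    {e : E} (hp : e ∈ touches ends {x | ∃ P : arms ends ζ h, p P ∧ x ∈ P.1})
    (hq : e ∈ touches ends {x | ∃ P : arms ends ζ h, q P ∧ x ∈ P.1}) : False := by
  obtain ⟨x, ⟨P, hP, hxP⟩, y, hxy⟩ := hp
  obtain ⟨x', ⟨Q, hQ, hx'Q⟩, y', hxy'⟩ := hq
  -- the ends of `e` are `{x, y}` with `x ∈ P` and `{x', y'}` with `x' ∈ Q`
  rw [hxy, Sym2.eq_iff] at hxy'
  have hPQ : P = Q := by
    rcases hxy' with ⟨hx1, _⟩ | ⟨_, hy2⟩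
    · rw [← hx1] at hx'Q
      exact Subtype.ext (arms_eq_of_mem P.2 Q.2 hxP hx'Q)
    · -- `x' = y`: `y ∈ Q` and `x ∈ P` joined by `e`: `y ∈ P` by closedness
      rw [← hy2] at hx'Q
      have hyH := mem_hull_sdiff_of_mem_arms Q.2 hx'Q
      have hyP : y ∈ P.1 := (armClosed_of_mem_arms P.2).closed e x y hxy hxP hyH.1 hyH.2
      exact Subtype.ext (arms_eq_of_mem P.2 Q.2 hyP hx'Q)
  subst hPQ
  exact hpq P hP hQ

section OrbitReal

variable (hc : CoreFree ends ζ h)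
include hc

omit [DecidableEq E] in
/-- `armsFalse ω` is arm-closed for the all-red orientation. -/
lemma armClosed_armsFalse_allRed (ω : Config (arms ends ζ h)) :
    ArmClosed ends (allRed ends ζ h) h (armsFalse ends ζ h ω) :=
  armClosed_of_hull_eq (hull_allRed hc) (armClosed_armsFalse ω)

omit [DecidableEq E] in
/-- **The red cluster of a realisation**: the hull minus the arms assigned `false`. -/
theorem cluster_orbitReal (ω : Config (arms ends ζ h)) :
    cluster ends (orbitReal ends ζ h ω) h = hull ends ζ h \ armsFalse ends ζ h ω := by
  unfold orbitReal
  rw [cluster_flip_of_armClosed (coreFree_allRed hc) (armClosed_armsFalse_allRed hc ω),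
    cluster_allRed hc, cluster_blue_allRed hc]
  ext x
  simp only [Set.mem_union, Set.mem_sdiff, Set.mem_inter_iff, Set.mem_singleton_iff]
  constructor
  · rintro (h1 | ⟨hF, rfl⟩)
    · exact h1
    · exact absurd rfl (mem_hull_sdiff_of_mem_armsFalse hF).2
  · exact fun h1 => Or.inl h1

omit [DecidableEq E] in
/-- **The blue cluster of a realisation**: `h` together with the arms assigned `false`. -/
theorem cluster_blue_orbitReal (ω : Config (arms ends ζ h)) :
    cluster ends (blue (orbitReal ends ζ h ω)) h = insert h (armsFalse ends ζ h ω) := by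
  unfold orbitReal
  rw [cluster_blue_flip_of_armClosed (coreFree_allRed hc) (armClosed_armsFalse_allRed hc ω),
    cluster_blue_allRed hc, cluster_allRed hc]
  ext x
  simp only [Set.mem_union, Set.mem_sdiff, Set.mem_inter_iff, Set.mem_singleton_iff,
    Set.mem_insert_iff]
  constructor
  · rintro (⟨rfl, _⟩ | ⟨hF, _⟩)
    · exact Or.inl rfl
    · exact Or.inr hF
  · rintro (rfl | hF)
    · exact Or.inl ⟨rfl, fun h' => (mem_hull_sdiff_of_mem_armsFalse h').2 rfl⟩
    · exact Or.inr ⟨hF, (mem_hull_sdiff_of_mem_armsFalse hF).1⟩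

omit [DecidableEq E] in
/-- The hull of a realisation. -/
theorem hull_orbitReal (ω : Config (arms ends ζ h)) :
    hull ends (orbitReal ends ζ h ω) h = hull ends ζ h := by
  unfold orbitReal
  rw [hull_flip_of_armClosed (coreFree_allRed hc) (armClosed_armsFalse_allRed hc ω), hull_allRed hc]

omit [DecidableEq E] in
/-- A realisation is core-free. -/
theorem coreFree_orbitReal (ω : Config (arms ends ζ h)) :
    CoreFree ends (orbitReal ends ζ h ω) h :=
  coreFree_flip_of_armClosed (coreFree_allRed hc) (armClosed_armsFalse_allRed hc ω)

/-- A realisation lies in the class. -/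
theorem orbitReal_mem_outClass {U : Set V} {ξ : Config E} (hζ : ζ ∈ outClass ends U h ξ)
    (ω : Config (arms ends ζ h)) : orbitReal ends ζ h ω ∈ outClass ends U h ξ :=
  flip_mem_outClass_of_armClosed (allRed_mem_outClass hζ hc) (coreFree_allRed hc)
    (armClosed_armsFalse_allRed hc ω)

omit [DecidableEq E] hc in
/-- A star edge into an arm `P` touches `armsFalse ω` exactly when `ω P = false`. -/
lemma starEdge_touches_armsFalse_iff {e : E} {y : V} (hey : ends e = s(h, y)) {P : arms ends ζ h}
    (hyP : y ∈ P.1) (ω : Config (arms ends ζ h)) :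
    e ∈ touches ends (armsFalse ends ζ h ω) ↔ ω P = false := by
  constructor
  · rintro ⟨x, hx, z, hxz⟩
    rw [hey, Sym2.eq_iff] at hxz
    rcases hxz with ⟨rfl, rfl⟩ | ⟨rfl, rfl⟩
    · exact absurd rfl (mem_hull_sdiff_of_mem_armsFalse hx).2
    · obtain ⟨Q, hQ, hyQ⟩ := hx
      have : Q = P := Subtype.ext (arms_eq_of_mem Q.2 P.2 hyQ hyP)
      subst this; exact hQ
  · intro hP
    exact ⟨y, ⟨P, hP, hyP⟩, h, by rw [hey]; exact Sym2.eq_swap⟩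

omit [DecidableEq E] hc in
/-- **The realisation is injective.** -/
theorem orbitReal_injective : Function.Injective (orbitReal ends ζ h) := by
  intro ω ω' heq
  funext P
  by_contra hne
  obtain ⟨e, he, hPe⟩ := Finset.mem_image.1 P.2
  obtain ⟨y, hey, hyh, hyH, harm⟩ := armOfEdge_eq_arm he
  have hyP : y ∈ P.1 := by rw [← hPe, harm]; exact mem_arm_self y
  have h1 := starEdge_touches_armsFalse_iff hey hyP ω
  have h2 := starEdge_touches_armsFalse_iff hey hyP ω'
  have := congrFun heq e
  unfold orbitReal at this
  cases hω : ω P <;> cases hω' : ω' P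
  · exact hne (hω.trans hω'.symm)
  · rw [flip_apply_of_mem (h1.2 hω), flip_apply_of_notMem (fun h' => by
      rw [h2.1 h'] at hω'; exact absurd hω' (by decide))] at this
    exact absurd this (by cases allRed ends ζ h e <;> decide)
  · rw [flip_apply_of_notMem (fun h' => by rw [h1.1 h'] at hω; exact absurd hω (by decide)),
      flip_apply_of_mem (h2.2 hω')] at this
    exact absurd this (by cases allRed ends ζ h e <;> decide)
  · exact hne (hω.trans hω'.symm)

omit [DecidableEq E] hc in
/-- An edge with no end in `armsFalse ω` keeps the all-red colour. -/
lemma orbitReal_apply_of_notMem {ω : Config (arms ends ζ h)} {e : E}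
    (he : e ∉ touches ends (armsFalse ends ζ h ω)) :
    orbitReal ends ζ h ω e = allRed ends ζ h e := by
  unfold orbitReal; exact flip_apply_of_notMem he

omit [DecidableEq E] hc in
/-- An edge with an end in `armsFalse ω` has the opposite of the all-red colour. -/
lemma orbitReal_apply_of_mem {ω : Config (arms ends ζ h)} {e : E}
    (he : e ∈ touches ends (armsFalse ends ζ h ω)) :
    orbitReal ends ζ h ω e = !allRed ends ζ h e := by
  unfold orbitReal; exact flip_apply_of_mem he

omit [DecidableEq E] in
/-- **The red edge set of a realisation grows with `ω`.** -/
theorem redEdges_orbitReal_mono {ω ω' : Config (arms ends ζ h)} (hω : ω ≤ ω') :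
    redEdges ends (orbitReal ends ζ h ω) h ⊆ redEdges ends (orbitReal ends ζ h ω') h := by
  intro e he
  rw [mem_redEdges, cluster_orbitReal hc] at he ⊢
  obtain ⟨hred, x, hx, y, hy, hxy⟩ := he
  have hte : e ∉ touches ends (armsFalse ends ζ h ω) := by
    rintro ⟨z, hz, w, hzw⟩
    rw [hxy, Sym2.eq_iff] at hzw
    rcases hzw with ⟨rfl, _⟩ | ⟨_, rfl⟩
    · exact hx.2 hz
    · exact hy.2 hz
  have hte' : e ∉ touches ends (armsFalse ends ζ h ω') := fun h' => hte (by
    obtain ⟨z, hz, w, hzw⟩ := h'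
    exact ⟨z, armsFalse_anti hω hz, w, hzw⟩)
  refine ⟨?_, x, ⟨hx.1, fun h' => hx.2 (armsFalse_anti hω h')⟩,
    y, ⟨hy.1, fun h' => hy.2 (armsFalse_anti hω h')⟩, hxy⟩
  rw [orbitReal_apply_of_notMem hte'] at *
  rw [orbitReal_apply_of_notMem hte] at hred
  exact hred

end OrbitReal

end Orbit

end LocRows

end Summit.Ventures.PercRepro2
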